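import Mathlib
import Summits.AnomalousDissipation.AnomalousDissipation.Theses.WazewskiBlock
import Literature.Analysis.FluidPDE.GalerkinFlow
import Literature.Dynamics.ConleyIndex.PolyfacialBlock
import Summits.AnomalousDissipation.AnomalousDissipation.Theorems.WazewskiBlockUniformGalerkinTrapStubBlockToWindow
import Summits.AnomalousDissipation.AnomalousDissipation.Theorems.WazewskiBlockUniformGalerkinTrapStubExitClosedOfTransversal
import HarnessLib

/-!
# Crux `WazewskiBlock.UniformGalerkinTrap` (stmt-AnomalousDissipation-10352), line `SketchIdeator4`
# (card `gevrey-tail-lift`): the composition — entrance-faced transversal blocks at every level ⟹ the crux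

This definition-free support file makes the proved part of the line importable.  The line reads the
Zgliczyński–Mischaikow self-consistent bounds in Ważewski form: a regular polyfacial block of the Galerkin phase
flow whose faces split into LOW faces (`Sum.inl`) and TAIL faces (`Sum.inr`) that are strict ENTRANCE faces has
immediate exit set equal to its LOW exit set, so Conley's Ważewski hypothesis is non-retraction onto the low exit
set only.  Contents:

* `exitSet_eq_of_entrance` — the first-order exit set under entrance tail faces is the low exit set (pure logic);
* `isSemiflow_galerkinPhaseFlow_freqBall` — the Galerkin phase flow of order `N` is a continuous semiflow;
* `uniformGalerkinTrap_of_entranceFacedBlocks` — THE BET of the line (entrance-faced transversal polyfacial block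
  data, relative to a closed forward-invariant set, inside the coefficient window, at every level `N ≥ N₀(ν)`, for
  every `0 < ν ≤ ν₀`) implies the crux BY NAME: exit set = low exit set and closed
  (`Sketch.stub_exitClosed_of_transversal`), Ważewski (`IsSemiflow.exists_forall_mem_of_not_retract`), block ⊆
  coefficient window ⟹ field orbit in the window (`Sketch.stub_blockToWindow`), clause block
  (`IsGalerkinMode.galerkinFlow_clauses`);
* `stub_uniformGalerkinTrap_of_entranceFacedBlocks` — the registered tools stub (same statement).

The bet is spelled out verbatim as registered in the skeleton `Cruxes/UniformGalerkinTrap/Lines/SketchIdeator4.lean`.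
References: Zgliczyński–Mischaikow 2001 (FoCM 1:255) Def 2.11, Thm 2.12, Cor 2.15; Conley 1978 Ch. II; Hartman 2002 Ch. X §3.
-/

noncomputable section

-- `Summit.<Summit>.<Problem>` is the tree's mandated summit-side namespace (CONVENTIONS §2); deliberate duplicate.
set_option linter.dupNamespace false

namespace Summit.AnomalousDissipation.AnomalousDissipation.Theorems.UniformGalerkinTrap.TailLift

open scoped InnerProductSpace ENNReal NNReal
open MeasureTheory Set Filter Topology
open Literature.Analysis.FunctionSpaces Literature.Analysis.FunctionSpaces.Torus
open Literature.Analysis.FluidPDE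
open Literature.Dynamics.ConleyIndex
open Summit.AnomalousDissipation.AnomalousDissipation.Theorems.UniformGalerkinTrap.Sketch
  (stub_blockToWindow stub_exitClosed_of_transversal)

/-- **Exit set under entrance faces.** If every active tail face (`Sum.inr`) is a strict entrance face on `B`
(`h (inr j) x = 0 → 0 < d (inr j) x`), the first-order exit set `{x ∈ B | ∃ i, h i x = 0 ∧ d i x < 0}` equals the
LOW exit set `{x ∈ B | ∃ i, h (inl i) x = 0 ∧ d (inl i) x < 0}` (Zgliczyński–Mischaikow's condition C4a removes the
tail faces from the exit set). [folklore] -/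
theorem exitSet_eq_of_entrance {X : Type*} {ι₁ ι₂ : Type*} {h d : ι₁ ⊕ ι₂ → X → ℝ} {B : Set X}
    (hent : ∀ x ∈ B, ∀ j : ι₂, h (Sum.inr j) x = 0 → 0 < d (Sum.inr j) x) :
    {x | x ∈ B ∧ ∃ i, h i x = 0 ∧ d i x < 0} =
      {x | x ∈ B ∧ ∃ i : ι₁, h (Sum.inl i) x = 0 ∧ d (Sum.inl i) x < 0} := by
  ext x
  simp only [mem_setOf_eq]
  constructor
  · rintro ⟨hxB, i, hi, hdi⟩
    refine ⟨hxB, ?_⟩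
    rcases i with i | j
    · exact ⟨i, hi, hdi⟩
    · exact absurd hdi (not_lt.2 (hent x hxB j hi).le)
  · rintro ⟨hxB, i, hi, hdi⟩
    exact ⟨hxB, Sum.inl i, hi, hdi⟩

/-- The Galerkin phase flow of order `N` (viscosity `ν ≥ 0`, integrable steady force) is a continuous semiflow
on the phase space `↥(galerkinSubspace (freqBall N))` (`galerkinPhaseFlow_semiflow`). [folklore] -/
theorem isSemiflow_galerkinPhaseFlow_freqBall {ν : ℝ} (hν : 0 ≤ ν)
    {f : UnitAddTorus (Fin 3) → EuclideanSpace ℝ (Fin 3)} (hf : Integrable f volume) (N : ℕ) :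
    IsSemiflow (galerkinPhaseFlow ν (fourierRestrict (freqBall (d := Fin 3) N) f)) := by
  obtain ⟨h1, h2, h3⟩ := galerkinPhaseFlow_semiflow (S := freqBall (d := Fin 3) N) hν
    neg_mem_freqBall_of_mem (isRealCoeff_mFourierCoeff (S := freqBall (d := Fin 3) N) hf) (ν := ν)
  exact ⟨h1, h2, h3⟩

/-- **Entrance-faced transversal blocks at every level ⟹ the crux.** At every `(ν, N)` the block `B = faceSet h ∩ M`
has immediate exit set equal to its LOW exit set (`stub_exitClosed_of_transversal`, `exitSet_eq_of_entrance`),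
closed; non-retraction onto the low exit set is then Conley's Ważewski hypothesis, so
`IsSemiflow.exists_forall_mem_of_not_retract` traps a phase point in `B ⊆` coefficient window for all `t ≥ 0`;
`stub_blockToWindow` gives a Galerkin mode whose `Torus.galerkinFlow` orbit stays in the window and
`IsGalerkinMode.galerkinFlow_clauses` the clause block. [folklore] -/
theorem uniformGalerkinTrap_of_entranceFacedBlocks :
    (∃ (m : ℕ) (f : UnitAddTorus (Fin 3) → EuclideanSpace ℝ (Fin 3)),
      ((IsSmooth f ∧ IsDivFree f ∧ ∀ k : Fin 3 → ℤ, ((m : ℕ) : ℝ) ^ 2 < freqNormSq k →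
        UnitAddTorus.mFourierCoeff (EuclideanSpace.complexify ∘ f) k = 0) ∧ HasZeroMean f) ∧
      ∃ (E ε₀ ν₀ : ℝ), 0 < ε₀ ∧ 0 < ν₀ ∧
        ∀ ν : ℝ, 0 < ν → ν ≤ ν₀ → ∃ (G : ℝ≥0) (N₀ : ℕ), ∀ N : ℕ, N₀ ≤ N →
          ∃ (n₁ n₂ : ℕ)
            (h d : Fin n₁ ⊕ Fin n₂ → ↥(galerkinSubspace (freqBall N : Finset (Fin 3 → ℤ))) → ℝ)
            (M : Set ↥(galerkinSubspace (freqBall N : Finset (Fin 3 → ℤ)))),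
            (∀ i, Continuous (h i)) ∧ (∀ i, Continuous (d i)) ∧
            (∀ i x t, 0 < t → HasDerivAt
              (fun s => h i (galerkinPhaseFlow ν (fourierRestrict (freqBall N : Finset (Fin 3 → ℤ)) f) s x))
              (d i (galerkinPhaseFlow ν (fourierRestrict (freqBall N : Finset (Fin 3 → ℤ)) f) t x)) t) ∧
            IsClosed M ∧
            (∀ x ∈ M, ∀ t : ℝ, 0 ≤ t →
              galerkinPhaseFlow ν (fourierRestrict (freqBall N : Finset (Fin 3 → ℤ)) f) t x ∈ M) ∧
            (∀ x ∈ faceSet h ∩ M, ∀ i, h i x = 0 → d i x ≠ 0) ∧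
            (∀ x ∈ faceSet h ∩ M, ∀ j : Fin n₂, h (Sum.inr j) x = 0 → 0 < d (Sum.inr j) x) ∧
            (¬ ∃ r : ↥(galerkinSubspace (freqBall N : Finset (Fin 3 → ℤ))) →
                  ↥(galerkinSubspace (freqBall N : Finset (Fin 3 → ℤ))),
                ContinuousOn r (faceSet h ∩ M) ∧
                MapsTo r (faceSet h ∩ M)
                  {x | x ∈ faceSet h ∩ M ∧ ∃ i : Fin n₁, h (Sum.inl i) x = 0 ∧ d (Sum.inl i) x < 0} ∧
                ∀ x ∈ {x | x ∈ faceSet h ∩ M ∧ ∃ i : Fin n₁, h (Sum.inl i) x = 0 ∧ d (Sum.inl i) x < 0},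
                  r x = x) ∧
            faceSet h ∩ M ⊆ {x |
              2⁻¹ * ∑ k, ‖(x : ↥(freqBall N : Finset (Fin 3 → ℤ)) → EuclideanSpace ℂ (Fin 3)) k‖ ^ 2 ≤ E ∧
              ε₀ ≤ ∑ k, (inner ℂ (fourierRestrict (freqBall N : Finset (Fin 3 → ℤ)) f k)
                ((x : ↥(freqBall N : Finset (Fin 3 → ℤ)) → EuclideanSpace ℂ (Fin 3)) k)).re ∧
              4 * Real.pi ^ 2 * ∑ k, freqNormSq ((k : ↥(freqBall N : Finset (Fin 3 → ℤ))) : Fin 3 → ℤ) *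
                ‖(x : ↥(freqBall N : Finset (Fin 3 → ℤ)) → EuclideanSpace ℂ (Fin 3)) k‖ ^ 2 ≤ (G : ℝ)}) →
      Summit.AnomalousDissipation.AnomalousDissipation.Theses.WazewskiBlock.UniformGalerkinTrap := by
  rintro ⟨m, f, hf, E, ε₀, ν₀, hε₀, hν₀, hall⟩
  refine ⟨m, f, hf.1, hf.2, E, ε₀, ν₀, hε₀, hν₀, fun ν hν hνle => ?_⟩
  obtain ⟨G, N₀, hN⟩ := hall ν hν hνle
  refine ⟨G, N₀, fun N hN₀ => ?_⟩
  obtain ⟨n₁, n₂, h, d, M, hh, hd, hder, hM, hinv, htrans, hent, hnr, hwin⟩ := hN N hN₀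
  have hfi : Integrable f volume := hf.1.1.continuous.integrable_unitAddTorus
  have hf2 : MemLp f 2 volume := hf.1.1.memLp 2
  have hsf : IsSemiflow (galerkinPhaseFlow ν (fourierRestrict (freqBall (d := Fin 3) N) f)) :=
    isSemiflow_galerkinPhaseFlow_freqBall hν.le hfi N
  -- the exit set of the block: explicit, low faces only, closed
  obtain ⟨heq, hclosed⟩ := stub_exitClosed_of_transversal
    (galerkinPhaseFlow ν (fourierRestrict (freqBall (d := Fin 3) N) f)) h d M hsf hh hd hder hM hinv htrans
  have hlow := exitSet_eq_of_entrance (h := h) (d := d) (B := faceSet h ∩ M) hent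
  have hB : IsClosed (faceSet h ∩ M) := (isClosed_faceSet hh).inter hM
  have hnr' : ¬ ∃ r : ↥(galerkinSubspace (freqBall (d := Fin 3) N)) → ↥(galerkinSubspace (freqBall (d := Fin 3) N)),
      ContinuousOn r (faceSet h ∩ M) ∧
      MapsTo r (faceSet h ∩ M)
        (immediateExitSet (galerkinPhaseFlow ν (fourierRestrict (freqBall (d := Fin 3) N) f)) (faceSet h ∩ M)) ∧
      ∀ x ∈ immediateExitSet (galerkinPhaseFlow ν (fourierRestrict (freqBall (d := Fin 3) N) f)) (faceSet h ∩ M),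
        r x = x := by
    rw [heq, hlow]
    exact hnr
  -- Ważewski: a phase point trapped in the block
  obtain ⟨x, hx, htrap⟩ := hsf.exists_forall_mem_of_not_retract hB hclosed hnr'
  -- block ⊆ coefficient window ⟹ field orbit in the window
  obtain ⟨hmode, hwin'⟩ := stub_blockToWindow ν N f E ε₀ G x hν.le hf2 (fun t ht => hwin (htrap t ht))
  obtain ⟨-, hcont, hslice, htest, henergy⟩ := hmode.galerkinFlow_clauses (ν := ν) hν.le hf2
  exact ⟨fun t => Torus.galerkinFlow ν f N t (realTrigPoly (freqBall (d := Fin 3) N)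
      (coeffExt (freqBall (d := Fin 3) N) (x : ↥(freqBall (d := Fin 3) N) → EuclideanSpace ℂ (Fin 3)))),
    ⟨hcont, fun t ht => hslice t ht, fun b hb s t hs hst => htest b hb s t hs hst, henergy⟩, hwin'⟩

/-- **Registered tools stub** (`ledger workitem stub-add stmt-AnomalousDissipation-10352 --name
stub_uniformGalerkinTrap_of_entranceFacedBlocks`): THE BET of line `SketchIdeator4` implies the crux. [folklore] -/
theorem stub_uniformGalerkinTrap_of_entranceFacedBlocks :
    (∃ (m : ℕ) (f : UnitAddTorus (Fin 3) → EuclideanSpace ℝ (Fin 3)),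
      ((IsSmooth f ∧ IsDivFree f ∧ ∀ k : Fin 3 → ℤ, ((m : ℕ) : ℝ) ^ 2 < freqNormSq k →
        UnitAddTorus.mFourierCoeff (EuclideanSpace.complexify ∘ f) k = 0) ∧ HasZeroMean f) ∧
      ∃ (E ε₀ ν₀ : ℝ), 0 < ε₀ ∧ 0 < ν₀ ∧
        ∀ ν : ℝ, 0 < ν → ν ≤ ν₀ → ∃ (G : ℝ≥0) (N₀ : ℕ), ∀ N : ℕ, N₀ ≤ N →
          ∃ (n₁ n₂ : ℕ)
            (h d : Fin n₁ ⊕ Fin n₂ → ↥(galerkinSubspace (freqBall N : Finset (Fin 3 → ℤ))) → ℝ)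
            (M : Set ↥(galerkinSubspace (freqBall N : Finset (Fin 3 → ℤ)))),
            (∀ i, Continuous (h i)) ∧ (∀ i, Continuous (d i)) ∧
            (∀ i x t, 0 < t → HasDerivAt
              (fun s => h i (galerkinPhaseFlow ν (fourierRestrict (freqBall N : Finset (Fin 3 → ℤ)) f) s x))
              (d i (galerkinPhaseFlow ν (fourierRestrict (freqBall N : Finset (Fin 3 → ℤ)) f) t x)) t) ∧
            IsClosed M ∧
            (∀ x ∈ M, ∀ t : ℝ, 0 ≤ t →
              galerkinPhaseFlow ν (fourierRestrict (freqBall N : Finset (Fin 3 → ℤ)) f) t x ∈ M) ∧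
            (∀ x ∈ faceSet h ∩ M, ∀ i, h i x = 0 → d i x ≠ 0) ∧
            (∀ x ∈ faceSet h ∩ M, ∀ j : Fin n₂, h (Sum.inr j) x = 0 → 0 < d (Sum.inr j) x) ∧
            (¬ ∃ r : ↥(galerkinSubspace (freqBall N : Finset (Fin 3 → ℤ))) →
                  ↥(galerkinSubspace (freqBall N : Finset (Fin 3 → ℤ))),
                ContinuousOn r (faceSet h ∩ M) ∧
                MapsTo r (faceSet h ∩ M)
                  {x | x ∈ faceSet h ∩ M ∧ ∃ i : Fin n₁, h (Sum.inl i) x = 0 ∧ d (Sum.inl i) x < 0} ∧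
                ∀ x ∈ {x | x ∈ faceSet h ∩ M ∧ ∃ i : Fin n₁, h (Sum.inl i) x = 0 ∧ d (Sum.inl i) x < 0},
                  r x = x) ∧
            faceSet h ∩ M ⊆ {x |
              2⁻¹ * ∑ k, ‖(x : ↥(freqBall N : Finset (Fin 3 → ℤ)) → EuclideanSpace ℂ (Fin 3)) k‖ ^ 2 ≤ E ∧
              ε₀ ≤ ∑ k, (inner ℂ (fourierRestrict (freqBall N : Finset (Fin 3 → ℤ)) f k)
                ((x : ↥(freqBall N : Finset (Fin 3 → ℤ)) → EuclideanSpace ℂ (Fin 3)) k)).re ∧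
              4 * Real.pi ^ 2 * ∑ k, freqNormSq ((k : ↥(freqBall N : Finset (Fin 3 → ℤ))) : Fin 3 → ℤ) *
                ‖(x : ↥(freqBall N : Finset (Fin 3 → ℤ)) → EuclideanSpace ℂ (Fin 3)) k‖ ^ 2 ≤ (G : ℝ)}) →
      Summit.AnomalousDissipation.AnomalousDissipation.Theses.WazewskiBlock.UniformGalerkinTrap :=
  uniformGalerkinTrap_of_entranceFacedBlocks

end Summit.AnomalousDissipation.AnomalousDissipation.Theorems.UniformGalerkinTrap.TailLift

end
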